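import Literature.Geometry.GaugeTheory.AsdConnectionFlatModelGauge
import Mathlib.Topology.UniformSpace.UniformConvergenceTopology
import HarnessLib

/-!
# The curvature density is continuous for the `C^∞` topology on connections

Topic `Literature/Geometry/GaugeTheory`; companion *proofs* file (theorems only: no definition, no
named fact) of `AsdModuliSpace.lean`.

`AsdModuliSpace.lean` gives the space of connections on `P_k → X` (any `4`-manifold `X` of the
tree's setting) the `C^∞` topology — the initial topology of the jets
`A ↦ D^m(A_i ∘ φ_{x₀}⁻¹)` with values in the spaces of functions with the topology of uniform
convergence on the compact subsets of the chart images of the patches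
(`SpOneConnection.instTopologicalSpace`; Donaldson–Kronheimer 1990, §4.2) — and `M_k` its
quotient. This file proves that the basic local functional of the theory, the **curvature density
`ρ_A(x) = |F_A|²_g(x)`** (`SpOneConnection.curvatureDensity`), is **continuous in `A`** for that
topology, for every base point `x` and every metric `g` (`SpOneConnection.continuous_curvatureDensity`,
`AsdConnection.continuous_curvatureDensity`), and hence — over the flat base, where gauge
invariance of `ρ` is in the tree (`AsdModuliSpace.density_mk`) — that
**`[A] ↦ ρ_{[A]}(x)` is continuous on the moduli space `M_k(ℝ⁴, g)`**
(`AsdModuliSpace.continuous_density_apply`).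

The chain: the jets are continuous by definition and evaluation at a point of a member of the
family of compacts is continuous (`SpOneConnection.continuous_iteratedFDerivWithin_inChart`); the
value `A_i(x)(u)` and the exterior derivative `dA_i(x)(u, v)` are read off the `0`- and `1`-jet
of the chart representative at the chart point (`QuatOneForm.inChart_toMForm_apply_self`,
`QuatOneForm.extDeriv_eq_extDerivWithin_inChart`, the latter by definition of the tree's
`mextDeriv`); hence `A ↦ F_A(x)(u, v)` is continuous (`SpOneConnection.continuous_curvature_apply`),
and `|F|²_g(x)` is a fixed finite sum of squares of norms of such values.

## References

* S. K. Donaldson, P. B. Kronheimer, *The Geometry of Four-Manifolds* (1990), §2.1 (`|F_A|²`),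
  §4.2 (the topology of the space of connections and of `M_k`). [DonaldsonKronheimer1990]
-/

noncomputable section

open scoped Manifold ContDiff Topology Quaternion UniformConvergence
open Set Function Filter Topology
open Literature.Geometry.Kaehler (MForm)
open Literature.Geometry.Lorentzian (PseudoRiemannianMetric)
open Literature.Topology.FourManifolds (SmoothOrientation)

namespace Literature.Geometry.GaugeTheory

/-! ### A calculus lemma: the first derivative as the curried `1`-jet -/

/-- The Fréchet derivative within a set is the curried first iterated derivative. [folklore] -/
theorem fderivWithin_eq_continuousMultilinearCurryFin1 {E F : Type*} [NormedAddCommGroup E]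
    [NormedSpace ℝ E] [NormedAddCommGroup F] [NormedSpace ℝ F] (f : E → F) (s : Set E) {x : E}
    (hs : UniqueDiffWithinAt ℝ s x) :
    fderivWithin ℝ f s x =
      continuousMultilinearCurryFin1 ℝ E F (iteratedFDerivWithin ℝ 1 f s x) := by
  ext w
  rw [continuousMultilinearCurryFin1_apply, iteratedFDerivWithin_one_apply hs]
  rfl

variable {X : Type*} [TopologicalSpace X] [ChartedSpace (EuclideanSpace ℝ (Fin 4)) X]
  [IsManifold (𝓡 4) ∞ X]

/-! ### Values and exterior derivatives of a `1`-form through its chart representative -/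

namespace QuatOneForm

/-- **The value of a `1`-form from its chart representative**: at the chart point, the
representative of `B` in the chart at `x`, fed the push-forward `dφ_x(u)` of a tangent vector,
returns `B(x)(u)` (the derivative of `φ_x⁻¹` within `range I` inverts `dφ_x`). [folklore] -/
theorem inChart_toMForm_apply_self (B : QuatOneForm X) (x : X) (u : TangentSpace (𝓡 4) x) :
    B.toMForm.inChart x (extChartAt (𝓡 4) x x)
        (fun _ ↦ mfderiv (𝓡 4) 𝓘(ℝ, EuclideanSpace ℝ (Fin 4)) (extChartAt (𝓡 4) x) x u) =
      B x u := by
  rw [MForm.inChart_apply, toMForm_apply]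
  have key : ∀ y : X, y = x → ∀ w : EuclideanSpace ℝ (Fin 4), B y w = B x w := by
    rintro y rfl w
    rfl
  rw [key _ (extChartAt_to_inv (I := 𝓡 4) x)]
  congr 1
  exact DFunLike.congr_fun
    (mfderivWithin_extChartAt_symm_comp_mfderiv_extChartAt' (I := 𝓡 4) (mem_extChartAt_source x)) u

omit [IsManifold (𝓡 4) ∞ X] in
/-- **The exterior derivative of a `1`-form from its chart representative** (definition of the
tree's `mextDeriv`): `dB(x)(u, v)` is Mathlib's `extDerivWithin` of the representative, within
`range I` at the chart point, on the push-forwards `dφ_x(u), dφ_x(v)`. [folklore] -/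
theorem extDeriv_eq_extDerivWithin_inChart (B : QuatOneForm X) (x : X)
    (u v : TangentSpace (𝓡 4) x) :
    B.extDeriv x u v =
      extDerivWithin (B.toMForm.inChart x) (range (𝓡 4)) (extChartAt (𝓡 4) x x)
        (fun j ↦ mfderiv (𝓡 4) 𝓘(ℝ, EuclideanSpace ℝ (Fin 4)) (extChartAt (𝓡 4) x) x
          (![u, v] j)) :=
  rfl

end QuatOneForm

/-! ### Continuity of jets, values, exterior derivatives, curvature and density -/

namespace SpOneConnection

variable {o : SmoothOrientation (𝓡 4) X} {k : ℤ} {p : X}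

/-- The jets `A ↦ D^m(A_i ∘ φ_{x₀}⁻¹)` are continuous for the `C^∞` topology (by its definition as
their initial topology). [cite: DonaldsonKronheimer1990, §4.2] -/
theorem continuous_jet (i : Fin 2) (x₀ : X) (m : ℕ) :
    Continuous fun A : SpOneConnection o k p ↦ A.jet i x₀ m :=
  continuous_iInf_dom (i := i) <| continuous_iInf_dom (i := x₀) <|
    continuous_iInf_dom (i := m) continuous_induced_dom

/-- **Point evaluations of the jets are continuous**: for a point `c` of the chart image of the
patch, `A ↦ D^m(A_i ∘ φ_{x₀}⁻¹)(c)` is continuous (evaluation at a point of a member `{c}` of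
the family of compacts is uniformly continuous for the topology of `𝔖`-convergence). [folklore] -/
theorem continuous_iteratedFDerivWithin_inChart {i : Fin 2} {x₀ : X} (m : ℕ)
    {c : EuclideanSpace ℝ (Fin 4)}
    (hc : c ∈ extChartAt (𝓡 4) x₀ '' (patch p i ∩ (extChartAt (𝓡 4) x₀).source)) :
    Continuous fun A : SpOneConnection o k p ↦
      iteratedFDerivWithin ℝ m ((A.form i).toMForm.inChart x₀) (range (𝓡 4)) c := by
  have hK : ({c} : Set (EuclideanSpace ℝ (Fin 4))) ∈ jetDomains p i x₀ :=
    ⟨isCompact_singleton, singleton_subset_iff.2 hc⟩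
  exact (UniformOnFun.uniformContinuous_eval_of_mem _ _ (mem_singleton c) hK).continuous.comp
    (continuous_jet i x₀ m)

omit [IsManifold (𝓡 4) ∞ X] in
/-- The chart point lies in the chart image of any patch containing the point. [folklore] -/
theorem extChartAt_self_mem_image {i : Fin 2} {x : X} (hx : x ∈ patch p i) :
    extChartAt (𝓡 4) x x ∈ extChartAt (𝓡 4) x '' (patch p i ∩ (extChartAt (𝓡 4) x).source) :=
  ⟨x, ⟨hx, mem_extChartAt_source x⟩, rfl⟩

/-- **`A ↦ A_i(x)(u)` is continuous** for the `C^∞` topology (`x ∈ patch i`, `u ∈ T_x X`): the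
value is the `0`-jet of the chart representative at the chart point on `dφ_x(u)`. [folklore] -/
theorem continuous_form_apply (i : Fin 2) {x : X} (hx : x ∈ patch p i)
    (u : TangentSpace (𝓡 4) x) : Continuous fun A : SpOneConnection o k p ↦ A.form i x u := by
  have h0 := continuous_iteratedFDerivWithin_inChart (o := o) (k := k) (i := i) 0
    (extChartAt_self_mem_image hx)
  have heq : ∀ A : SpOneConnection o k p, A.form i x u =
      (iteratedFDerivWithin ℝ 0 ((A.form i).toMForm.inChart x) (range (𝓡 4))
          (extChartAt (𝓡 4) x x)) Fin.elim0
        (fun _ ↦ mfderiv (𝓡 4) 𝓘(ℝ, EuclideanSpace ℝ (Fin 4)) (extChartAt (𝓡 4) x) x u) := by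
    intro A
    rw [iteratedFDerivWithin_zero_apply, QuatOneForm.inChart_toMForm_apply_self]
  simp_rw [heq]
  exact (continuous_eval_const _).comp ((continuous_eval_const _).comp h0)

/-- **`A ↦ dA_i(x)(u, v)` is continuous** for the `C^∞` topology (`x ∈ patch i`): the exterior
derivative is the alternatisation of the curried `1`-jet of the chart representative at the chart
point, evaluated on `dφ_x(u), dφ_x(v)`. [folklore] -/
theorem continuous_extDeriv_form (i : Fin 2) {x : X} (hx : x ∈ patch p i)
    (u v : TangentSpace (𝓡 4) x) :
    Continuous fun A : SpOneConnection o k p ↦ (A.form i).extDeriv x u v := by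
  have h1 := continuous_iteratedFDerivWithin_inChart (o := o) (k := k) (i := i) 1
    (extChartAt_self_mem_image hx)
  have hU : UniqueDiffWithinAt ℝ (range (𝓡 4)) (extChartAt (𝓡 4) x x) :=
    (ModelWithCorners.uniqueDiffOn _) _
      (extChartAt_target_subset_range x (mem_extChartAt_target x))
  simp_rw [QuatOneForm.extDeriv_eq_extDerivWithin_inChart, extDerivWithin,
    fderivWithin_eq_continuousMultilinearCurryFin1 _ _ hU]
  exact (continuous_eval_const _).comp
    ((ContinuousAlternatingMap.alternatizeUncurryFinCLM ℝ _ _).continuous.comp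
      ((continuousMultilinearCurryFin1 ℝ _ _).continuous.comp h1))

/-- **`A ↦ F_{A,i}(x)(u, v)` is continuous** for the `C^∞` topology (`x ∈ patch i`):
`F = dA + A ∧ A`. [cite: DonaldsonKronheimer1990, §4.2] -/
theorem continuous_curvature_apply (i : Fin 2) {x : X} (hx : x ∈ patch p i)
    (u v : TangentSpace (𝓡 4) x) :
    Continuous fun A : SpOneConnection o k p ↦ A.curvature i x u v :=
  (continuous_extDeriv_form i hx u v).add
    (((continuous_form_apply i hx u).mul (continuous_form_apply i hx v)).sub
      ((continuous_form_apply i hx v).mul (continuous_form_apply i hx u)))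

/-- `|F|²_g(x)` depends continuously on the 2-form through its finitely many frame values.
[folklore] -/
theorem continuous_twoFormNormSq_comp {S : Type*} [TopologicalSpace S]
    (g : PseudoRiemannianMetric (𝓡 4) ∞ (EuclideanSpace ℝ (Fin 4)) (TangentSpace (𝓡 4) : X → Type _))
    (x : X) {F : S → TangentSpace (𝓡 4) x → TangentSpace (𝓡 4) x → ℍ}
    (hF : ∀ u v, Continuous fun s ↦ F s u v) :
    Continuous fun s ↦ twoFormNormSq g x (F s) := by
  unfold twoFormNormSq
  split_ifs with h
  · refine continuous_finsetSum _ fun a _ ↦ continuous_finsetSum _ fun b _ ↦ ?_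
    split_ifs
    · unfold adNormSq
      exact continuous_const.mul ((hF _ _).norm.pow 2)
    · exact continuous_const
  · exact continuous_const

/-- **The curvature density `A ↦ ρ_A(x) = |F_A|²_g(x)` is continuous for the `C^∞` topology on
connections**, for every point `x` of the base and every metric `g` (Donaldson–Kronheimer 1990,
§2.1, §4.2: `|F_A|²` is a smooth local functional of `A`; here continuity, which is what the
topology of `M_k` is built to give). [cite: DonaldsonKronheimer1990, §4.2] -/
theorem continuous_curvatureDensity
    (g : PseudoRiemannianMetric (𝓡 4) ∞ (EuclideanSpace ℝ (Fin 4)) (TangentSpace (𝓡 4) : X → Type _))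
    (x : X) : Continuous fun A : SpOneConnection o k p ↦ A.curvatureDensity g x :=
  continuous_twoFormNormSq_comp g x fun u v ↦
    continuous_curvature_apply _ (mem_patch_patchIndex p x) u v

end SpOneConnection

/-- **`ρ_A(x)` is continuous on the space of `g`-ASD connections** (subspace topology).
[cite: DonaldsonKronheimer1990, §4.2] -/
theorem AsdConnection.continuous_curvatureDensity
    (g : PseudoRiemannianMetric (𝓡 4) ∞ (EuclideanSpace ℝ (Fin 4)) (TangentSpace (𝓡 4) : X → Type _))
    {o : SmoothOrientation (𝓡 4) X} {k : ℤ} {p : X} (x : X) :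
    Continuous fun A : AsdConnection g o k p ↦ A.1.curvatureDensity g x :=
  (SpOneConnection.continuous_curvatureDensity g x).comp continuous_subtype_val

/-- **`[A] ↦ ρ_{[A]}(x)` is continuous on the moduli space `M_k(ℝ⁴, g)`** (quotient `C^∞`
topology; flat base, any metric `g` on it, where the gauge invariance `ρ_{[A]} = ρ_A` is in the
tree as `AsdModuliSpace.density_mk`). [cite: DonaldsonKronheimer1990, §4.2] -/
theorem AsdModuliSpace.continuous_density_apply
    (g : PseudoRiemannianMetric (𝓡 4) ∞ (EuclideanSpace ℝ (Fin 4))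
      (TangentSpace (𝓡 4) : EuclideanSpace ℝ (Fin 4) → Type _))
    {o : SmoothOrientation (𝓡 4) (EuclideanSpace ℝ (Fin 4))} {k : ℤ} (x : EuclideanSpace ℝ (Fin 4)) :
    Continuous fun c : AsdModuliSpace g o k ↦ c.density g x := by
  refine isQuotientMap_quot_mk.continuous_iff.2 ?_
  exact (AsdConnection.continuous_curvatureDensity g x).congr fun A ↦
    (congr_fun (AsdModuliSpace.density_mk A) x).symm

end Literature.Geometry.GaugeTheory

end
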